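import Literature.LinearAlgebra.Matrix.SL2ZIrreducibleNormalForms
import Mathlib.LinearAlgebra.Matrix.Charpoly.Minpoly
import Mathlib.Analysis.SpecialFunctions.Pow.Real
import HarnessLib

/-!
# Hertling–Larabi 2026b §7.1 and LEMMA 7.6: the five types of integer `2 × 2` matrices `(a b; c d)` read off from
# `4D = (a − d)² + 4bc` and the binary quadratic form `q = [c, d − a, −b]` — type I ⟺ `q = 0`; type II ⟺
# `D = 0`, `q ≠ 0` (then `q` semidefinite, isotropic); type III ⟺ `D > 0`, `4D` a square (then `q` indefinite,
# isotropic); type IV ⟺ `D > 0`, `4D` not a square (then `q` indefinite, `bc ≠ 0`, anisotropic); type V ⟺ `D < 0`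
# (then `bc < 0`, `q` definite with the sign of `c`); the eigenvalues `r/2 ± √D` and the row eigenvector
# `(c, −a + λ_1)`; «only `B` of type I is not regular»

[topic LinearAlgebra/Matrix] Sequel to `IntegerMatrixBinaryQuadraticForms` (HL26b Lemma 7.2 (b): `B ↦ q_B = [c, d−a, −b]`)
and `SL2ZIrreducibleNormalForms` (Thm. 7.10 (a): `bc ≠ 0` for `4D` a non-square, `bc < 0` for `D < 0`).  Lane
`lit-hodgefound` (Track 2 foundations library), seat p19 generation 39, row g39-#4.  THEOREMS ONLY: no definition, no
instance, no notation, no named fact (D-0026, net Literature debt `0`), no `sorry`.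

Conventions.  `(a b; c d)` is `!![a, b; c, d]`; `q = ⟨c, d − a, −b⟩ : BinQF` (the tree's binary forms,
`BinQF.eval q x y = cx² + (d − a)xy − by²`); `4D = (a − d)² + 4bc = (a + d)² − 4(ad − bc) = disc q`.  HL's types are
defined by the eigenvalues (chunk p0014): «Type I: `B` is semisimple with `λ_1 = λ_2 ∈ ℤ`. Then `B = λ_1·E_2`.  Type II:
`B` has a `2×2` Jordan block with eigenvalue `λ_1 = λ_2 ∈ ℤ`.  Type III: `B` is semisimple with `λ_1, λ_2 ∈ ℤ` and
`λ_1 ≠ λ_2`.  Type IV: `B` is semisimple with `λ_1, λ_2 ∈ ℝ − ℤ` and `λ_1 ≠ λ_2`.  Type V: `B` is semisimple with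
`λ_1, λ_2 ∈ ℂ − ℝ` and `λ_2 = λ̄_1`.»  Here type I is «`B = λE_2`», type II is «`B − λE_2` is nilpotent and `≠ 0` for
some `λ ∈ ℤ`», type III is «`p_B = (t − λ_1)(t − λ_2)`, `λ_1 ≠ λ_2 ∈ ℤ`» (`λ_1 + λ_2 = a + d`, `λ_1λ_2 = ad − bc`),
and types IV, V are taken in the form Lemma 7.6 (e), (f) gives them (`4D > 0` not a square; `4D < 0`); since a monic
integer quadratic with a rational root has integer roots, these five cases exhaust `M_{2×2}(ℤ)` (`types_exhaustive`).

## Source, VERBATIM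

C. Hertling, K. Larabi, *Conjugacy classes of regular integer matrices*, arXiv:2602.15748 (2026)
[HertlingLarabi2026b], held `paper:arxiv-2602.15748`, §7.1–7.2, chunks p0014–p0015: the five types (above);
«Only `B` of type I is not regular.» and
«**Lemma 7.6.** Let `B = (a b; c d) ∈ M_{2×2}(ℤ)`, and let `q = [c, d−a, −b]_quad` be the associated binary quadratic
form. (a) The characteristic polynomial `p_B(t) = t² − rt + s ∈ ℤ[t]` satisfies `r = tr B = a + d`,
`s = det B = ad − bc`. The eigenvalues `λ_1` and `λ_2` of `B` are `λ_{1/2} = r/2 ± √D` with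
`D = r²/4 − s = ((a−d)/2)² + bc`. Here `√D` is the square root with `√D ∈ ℝ_{≥0} ∪ iℝ_{>0}`. One row eigenvector `v_1`
of `B` with eigenvalue `λ_1`, so with `v_1B = λ_1v_1`, is `v_1 = (c, −a + λ_1) = (c, (d−a)/2 + √D)` (7.1) if `v_1 ≠ 0`.
(b) `B` is of type I ⟺ `q = 0`.
(c) `B` is of type II ⟺ `D = 0` and `q ≠ 0`. Then `q` is semidefinite with `0 ∈ q(ℤ² − {0})`.
(d) `B` is of type III ⟺ `D > 0` and `4D ∈ ℕ` is a square. Then `q` is indefinite with `0 ∈ q(ℤ² − {0})`.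
(e) `B` is of type IV ⟺ `D > 0` and `4D ∈ ℕ` is not a square. Then `A = ℚ[√δ]` for the square free `δ ∈ ℕ` with
`4D = δ·(a square)`. We choose `t̄ = λ_1`. Then `q` is indefinite with `bc ≠ 0` and `0 ∉ q(ℤ² − {0})`.
(f) `B` is of type V ⟺ `D < 0`. Then `A = ℚ[√δ]` for the `δ ∈ ℤ_{<0}` with `|δ|` square free and
`4D = δ·(a square)`. We choose `t̄ = λ_1`. Then `bc < 0`, `q` is positive definite if `c > 0`, and `q` is negative
definite if `c < 0`.
Proof: Part (a) and most of the parts (b) to (f) are obvious. Observe `det (c, (d−a)/2; (d−a)/2, −b) = −D`.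
Therefore `q = [c, d−a, −b]_quad` is indefinite if `D > 0` and positive or negative definite if `D < 0`. □»

## What is proved

* §1 **(a)**: `discr_eq` (`(a+d)² − 4(ad−bc) = (a−d)² + 4bc = disc q`), `vecMul_eq_smul_of_isRoot` ((7.1): `(c, λ − a)`
  is a row eigenvector for every root `λ` of `p_B`, in any commutative ring), `real_eigenvalues` and
  `complex_eigenvalues` (`r/2 ± √D` resp. `r/2 ± i√(−D)` are roots of `p_B`), `four_mul_eval`
  (`4c·q(x, y) = (2cx + (d−a)y)² − 4D·y²`, the determinant observation of the proof).
* §2 **(b)**: `binQF_eq_zero_iff` (type I ⟺ `q = 0`).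
* §3 **(c)**: `typeII_iff` (`∃ λ ∈ ℤ, B − λE_2 ≠ 0, (B − λE_2)² = 0` ⟺ `4D = 0 ∧ q ≠ 0`), `semidefinite_of_discr_eq_zero`,
  `exists_eval_eq_zero_of_isSquare` (isotropy for `4D` a square, covering (c) and (d)).
* §4 **(d)**: `typeIII_iff` (`∃ λ_1 ≠ λ_2 ∈ ℤ`, `λ_1 + λ_2 = a + d`, `λ_1λ_2 = ad − bc` ⟺ `4D > 0` a square),
  `indefinite_of_discr_pos` (for `4D > 0`, `q` takes both signs — (d) and (e)).
* §5 **(e)**: `typeIV` (`bc ≠ 0`, indefinite, and `eval_ne_zero_of_not_isSquare`: anisotropic).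
* §6 **(f)**: `typeV` (`bc < 0`; `q > 0` on `ℤ² − 0` if `c > 0`, `q < 0` if `c < 0`).
* §7 `types_exhaustive` (every `B` is of exactly… at least one of the five types, as characterised in (b)–(f)) and
  **`minpoly_eq_of_binQF_ne_zero`** («Only `B` of type I is not regular»: for `q ≠ 0` the minimal polynomial of `B`
  over `ℚ` is `p_B = t² − (tr B)t + det B` — the regularity hypothesis `minpoly_ℚ B = g` of the Latimer–MacDuffee
  files, discharged for every non-scalar `2 × 2` matrix).
NOT here: the square-free `δ` and `A = ℚ[√δ]` of (e), (f) (Theorem 7.7).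

## References

* [HertlingLarabi2026b] C. Hertling, K. Larabi, arXiv:2602.15748 (2026), §7.1 (the five types, regularity) and §7.2
  Lemma 7.6 with proof (chunks p0014–p0015). [cite: HertlingLarabi2026b, §7.2 Lemma 7.6, chunk p0015]
-/

open Polynomial

namespace Literature.LinearAlgebra.Matrix.IntegerMatrixTwoByTwoTypes

open Literature.NumberTheory.QuadraticFields.Quadratic (BinQF)
open Literature.NumberTheory.QuadraticFields.Quadratic.BinQF
open Literature.LinearAlgebra.Matrix.SL2ZIrreducibleNormalForms (mul_ne_zero_of_not_isSquare mul_neg_of_discr_neg)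

/-! ## §1 LEMMA 7.6 (a): `p_B`, `D`, the eigenvalues and the row eigenvector `(c, −a + λ_1)` -/

/-- **(a): `4D = r² − 4s = (a − d)² + 4bc`** («`D = r²/4 − s = ((a−d)/2)² + bc`», (7.2)) and this is the discriminant of
`q = [c, d − a, −b]`. [cite: HertlingLarabi2026b, §7.2 Lemma 7.6 (a) (7.2), chunk p0015] -/
theorem discr_eq (a b c d : ℤ) :
    (a + d) ^ 2 - 4 * (a * d - b * c) = (a - d) ^ 2 + 4 * (b * c) ∧
      (⟨c, d - a, -b⟩ : BinQF).disc = (a - d) ^ 2 + 4 * (b * c) := by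
  simp only [BinQF.disc]
  constructor <;> ring

/-- **(a), (7.1): `v_1 = (c, −a + λ_1)` is a row eigenvector, `v_1B = λ_1v_1`** — for EVERY root `λ` of
`p_B = t² − (a + d)t + (ad − bc)` in any commutative ring (`ℤ`, `ℝ`, `ℂ`, `ℚ[t]/(p_B)`).
[cite: HertlingLarabi2026b, §7.2 Lemma 7.6 (a) (7.1), chunk p0015] -/
theorem vecMul_eq_smul_of_isRoot {R : Type*} [CommRing R] (a b c d : ℤ) {l : R}
    (hl : l * l - ((a : R) + d) * l + ((a : R) * d - b * c) = 0) :
    Matrix.vecMul ![(c : R), l - a] !![(a : R), b; c, d] = l • ![(c : R), l - a] := by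
  ext i
  fin_cases i
  · simp [Matrix.vecMul, dotProduct, Fin.sum_univ_two]
    ring
  · simp [Matrix.vecMul, dotProduct, Fin.sum_univ_two]
    linear_combination (-1 : R) * hl

/-- **(a), real eigenvalues: for `4D = (a−d)² + 4bc ≥ 0` the numbers `λ_{1/2} = r/2 ± √D = (r ± √(4D))/2` are roots of
`p_B`** (types I–IV). [cite: HertlingLarabi2026b, §7.2 Lemma 7.6 (a), chunk p0015] -/
theorem real_eigenvalues (a b c d : ℤ) (hD : 0 ≤ ((a - d) ^ 2 + 4 * (b * c) : ℤ)) :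
    (∀ l : ℝ, (l = ((a : ℝ) + d + Real.sqrt ((a - d) ^ 2 + 4 * (b * c))) / 2 ∨
        l = ((a : ℝ) + d - Real.sqrt ((a - d) ^ 2 + 4 * (b * c))) / 2) →
      l * l - ((a : ℝ) + d) * l + ((a : ℝ) * d - b * c) = 0) := by
  have hD' : (0 : ℝ) ≤ (a - d) ^ 2 + 4 * (b * c) := by exact_mod_cast hD
  have hs := Real.mul_self_sqrt hD'
  rintro l (rfl | rfl)
  · linear_combination (1 / 4 : ℝ) * hs
  · linear_combination (1 / 4 : ℝ) * hs

/-- **(a), complex eigenvalues: for `4D < 0` the numbers `λ_{1/2} = r/2 ± i√(−D)` are roots of `p_B`** (type V,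
«`√D ∈ iℝ_{>0}`»). [cite: HertlingLarabi2026b, §7.2 Lemma 7.6 (a), chunk p0015] -/
theorem complex_eigenvalues (a b c d : ℤ) (hD : ((a - d) ^ 2 + 4 * (b * c) : ℤ) < 0) :
    (∀ l : ℂ, (l = ((a : ℂ) + d + Complex.I * Real.sqrt (-((a - d) ^ 2 + 4 * (b * c)))) / 2 ∨
        l = ((a : ℂ) + d - Complex.I * Real.sqrt (-((a - d) ^ 2 + 4 * (b * c)))) / 2) →
      l * l - ((a : ℂ) + d) * l + ((a : ℂ) * d - b * c) = 0) := by
  have hD' : (0 : ℝ) ≤ -((a - d) ^ 2 + 4 * (b * c)) := by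
    have : ((a - d) ^ 2 + 4 * (b * c) : ℝ) < 0 := by exact_mod_cast hD
    linarith
  have hs : ((Real.sqrt (-((a - d) ^ 2 + 4 * (b * c))) : ℂ)) * (Real.sqrt (-((a - d) ^ 2 + 4 * (b * c))) : ℂ) =
      -(((a : ℂ) - d) ^ 2 + 4 * (b * c)) := by
    have h := Real.mul_self_sqrt hD'
    have h' : ((Real.sqrt (-((a - d) ^ 2 + 4 * (b * c))) * Real.sqrt (-((a - d) ^ 2 + 4 * (b * c))) : ℝ) : ℂ) =
        ((-((a - d) ^ 2 + 4 * (b * c)) : ℝ) : ℂ) := by rw [h]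
    push_cast at h'
    exact h'
  have hI := Complex.I_mul_I
  rintro l (rfl | rfl)
  · linear_combination (-1 / 4 : ℂ) * hs + (((Real.sqrt (-((a - d) ^ 2 + 4 * (b * c))) : ℂ) ^ 2) / 4) * hI
  · linear_combination (-1 / 4 : ℂ) * hs + (((Real.sqrt (-((a - d) ^ 2 + 4 * (b * c))) : ℂ) ^ 2) / 4) * hI

/-- **Proof of Lemma 7.6, the determinant observation**: `4c·q(x, y) = (2cx + (d − a)y)² − 4D·y²` («Observe
`det (c, (d−a)/2; (d−a)/2, −b) = −D`. Therefore `q` is indefinite if `D > 0` and positive or negative definite if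
`D < 0`»). [cite: HertlingLarabi2026b, §7.2 Lemma 7.6 (proof), chunk p0015] -/
theorem four_mul_eval (a b c d x y : ℤ) :
    4 * c * (⟨c, d - a, -b⟩ : BinQF).eval x y = (2 * c * x + (d - a) * y) ^ 2 - ((a - d) ^ 2 + 4 * (b * c)) * y ^ 2 := by
  simp only [BinQF.eval]
  ring

/-- `B − λE_2 = (a−λ, b; c, d−λ)`. [folklore] -/
private theorem sub_smul_one (a b c d l : ℤ) :
    (!![a, b; c, d] : Matrix (Fin 2) (Fin 2) ℤ) - l • 1 = !![a - l, b; c, d - l] := by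
  ext i j
  rw [Matrix.sub_apply, Matrix.smul_apply, smul_eq_mul]
  fin_cases i <;> fin_cases j <;> simp

/-! ## §2 LEMMA 7.6 (b): type I -/

/-- **(b): «`B` is of type I ⟺ `q = 0`»** — `q = [c, d − a, −b] = 0` iff `B = λE_2` (`λ = a = d`, `b = c = 0`).
[cite: HertlingLarabi2026b, §7.2 Lemma 7.6 (b), chunk p0015] -/
theorem binQF_eq_zero_iff (a b c d : ℤ) :
    (⟨c, d - a, -b⟩ : BinQF) = ⟨0, 0, 0⟩ ↔ ∃ l : ℤ, (!![a, b; c, d] : Matrix (Fin 2) (Fin 2) ℤ) = l • 1 := by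
  constructor
  · intro h
    simp only [BinQF.mk.injEq, neg_eq_zero] at h
    obtain ⟨hc, hda, hb⟩ := h
    refine ⟨a, ?_⟩
    rw [← sub_eq_zero, sub_smul_one, sub_self, hb, hc, hda]
    ext i j
    fin_cases i <;> fin_cases j <;> rfl
  · rintro ⟨l, h⟩
    rw [← sub_eq_zero, sub_smul_one] at h
    have h01 := congr_fun (congr_fun h 0) 1
    have h10 := congr_fun (congr_fun h 1) 0
    have h00 := congr_fun (congr_fun h 0) 0
    have h11 := congr_fun (congr_fun h 1) 1
    simp at h00 h01 h10 h11
    rw [h10, h01, show d - a = 0 by omega, neg_zero]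

/-! ## §3 LEMMA 7.6 (c): type II -/

/-- Cayley–Hamilton for `2 × 2` matrices: `N² = (tr N)N − (det N)E_2`. [folklore] -/
private theorem mul_self_eq (N : Matrix (Fin 2) (Fin 2) ℤ) :
    N * N = N.trace • N - N.det • (1 : Matrix (Fin 2) (Fin 2) ℤ) := by
  ext i j
  rw [Matrix.sub_apply, Matrix.smul_apply, Matrix.smul_apply, smul_eq_mul, smul_eq_mul, Matrix.mul_apply,
    Matrix.trace_fin_two, Matrix.det_fin_two]
  fin_cases i <;> fin_cases j <;> simp [Fin.sum_univ_two] <;> ring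

/-- **(c): «`B` is of type II ⟺ `D = 0` and `q ≠ 0`»** — `B` has a `2 × 2` Jordan block with an integer eigenvalue
`λ` (`N = B − λE_2 ≠ 0` with `N² = 0`) iff `4D = (a − d)² + 4bc = 0` and `q ≠ 0`; then `λ = (a + d)/2`.
[cite: HertlingLarabi2026b, §7.2 Lemma 7.6 (c), chunk p0015] -/
theorem typeII_iff (a b c d : ℤ) :
    (∃ l : ℤ, (!![a, b; c, d] : Matrix (Fin 2) (Fin 2) ℤ) - l • 1 ≠ 0 ∧
        ((!![a, b; c, d] : Matrix (Fin 2) (Fin 2) ℤ) - l • 1) * ((!![a, b; c, d] : Matrix (Fin 2) (Fin 2) ℤ) - l • 1) = 0) ↔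
      (a - d) ^ 2 + 4 * (b * c) = 0 ∧ (⟨c, d - a, -b⟩ : BinQF) ≠ ⟨0, 0, 0⟩ := by
  constructor
  · rintro ⟨l, hne, hsq⟩
    rw [sub_smul_one] at hne hsq
    -- `det N = 0` (from `det(N²) = 0`) and then `tr N = 0` (from `N² = (tr N)N = 0`, `N ≠ 0`)
    have hdet : (!![a - l, b; c, d - l] : Matrix (Fin 2) (Fin 2) ℤ).det = 0 := by
      have h := congrArg Matrix.det hsq
      rw [Matrix.det_mul, Matrix.det_zero] at h
      exact pow_eq_zero_iff two_ne_zero |>.1 (by rw [sq]; exact h)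
    have htr : (!![a - l, b; c, d - l] : Matrix (Fin 2) (Fin 2) ℤ).trace = 0 := by
      rw [mul_self_eq, hdet, zero_smul, sub_zero] at hsq
      by_contra htr
      exact hne ((smul_eq_zero.1 hsq).resolve_left htr)
    rw [Matrix.det_fin_two_of] at hdet
    rw [Matrix.trace_fin_two_of] at htr
    refine ⟨by linear_combination (-4 : ℤ) * hdet + (a + d - 2 * l) * htr, fun hq => hne ?_⟩
    simp only [BinQF.mk.injEq, neg_eq_zero] at hq
    obtain ⟨hc, hda, hb⟩ := hq
    have hal : a - l = 0 := by linarith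
    have hdl : d - l = 0 := by linarith
    rw [hal, hdl, hb, hc]
    ext i j
    fin_cases i <;> fin_cases j <;> rfl
  · rintro ⟨hD, hq⟩
    -- `a + d` is even: `(a + d)² = 4(ad − bc)`; `λ = (a + d)/2`
    have h4 : (a + d) ^ 2 = 2 * (2 * (a * d - b * c)) := by linear_combination hD
    have heven : Even (a + d) := (Int.even_pow' two_ne_zero).1 ⟨2 * (a * d - b * c), by rw [h4]; ring⟩
    obtain ⟨l, hl⟩ := heven
    refine ⟨l, ?_, ?_⟩
    · rw [sub_smul_one]
      intro h0
      have e00 := congr_fun (congr_fun h0 0) 0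
      have e01 := congr_fun (congr_fun h0 0) 1
      have e10 := congr_fun (congr_fun h0 1) 0
      have e11 := congr_fun (congr_fun h0 1) 1
      simp at e00 e01 e10 e11
      apply hq
      rw [e10, e01, show d - a = 0 by omega, neg_zero]
    · rw [sub_smul_one, mul_self_eq, Matrix.trace_fin_two_of, Matrix.det_fin_two_of]
      have htr : a - l + (d - l) = 0 := by linarith
      have h4 : 4 * ((a - l) * (d - l) - b * c) = 0 := by linear_combination -hD + (a + d - 2 * l) * hl
      have hdet : (a - l) * (d - l) - b * c = 0 := (mul_eq_zero.1 h4).resolve_left (by norm_num)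
      rw [htr, hdet, zero_smul, zero_smul, sub_zero]

/-- **(c): «Then `q` is semidefinite»** — for `4D = 0` the form `q = [c, d − a, −b]` is `≥ 0` everywhere or `≤ 0`
everywhere (`4c·q = (2cx + (d−a)y)²`; for `c = 0`, `d = a` and `q = −by²`).
[cite: HertlingLarabi2026b, §7.2 Lemma 7.6 (c), chunk p0015] -/
theorem semidefinite_of_discr_eq_zero {a b c d : ℤ} (hD : (a - d) ^ 2 + 4 * (b * c) = 0) :
    (∀ x y : ℤ, 0 ≤ (⟨c, d - a, -b⟩ : BinQF).eval x y) ∨ ∀ x y : ℤ, (⟨c, d - a, -b⟩ : BinQF).eval x y ≤ 0 := by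
  rcases lt_trichotomy c 0 with hc | hc | hc
  · refine Or.inr fun x y => ?_
    have h := four_mul_eval a b c d x y
    rw [hD, zero_mul, sub_zero] at h
    nlinarith [sq_nonneg (2 * c * x + (d - a) * y)]
  · subst hc
    have had : d - a = 0 := by nlinarith [hD]
    rcases le_or_gt 0 b with hb | hb
    · refine Or.inr fun x y => ?_
      simp only [BinQF.eval, had]
      nlinarith [sq_nonneg y]
    · refine Or.inl fun x y => ?_
      simp only [BinQF.eval, had]
      nlinarith [sq_nonneg y]
  · refine Or.inl fun x y => ?_
    have h := four_mul_eval a b c d x y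
    rw [hD, zero_mul, sub_zero] at h
    nlinarith [sq_nonneg (2 * c * x + (d - a) * y)]

/-- **(c), (d): «with `0 ∈ q(ℤ² − {0})`»** — if `4D = (a − d)² + 4bc` is a square (`4D = 0`, type II, or `4D > 0` a
square, types I and III) then `q` has a non-trivial zero: `(1, 0)` if `c = 0`, else `(k − (d − a), 2c)` for
`4D = k²`. [cite: HertlingLarabi2026b, §7.2 Lemma 7.6 (c)(d), chunk p0015] -/
theorem exists_eval_eq_zero_of_isSquare {a b c d : ℤ} (hD : IsSquare ((a - d) ^ 2 + 4 * (b * c))) :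
    ∃ x y : ℤ, (x ≠ 0 ∨ y ≠ 0) ∧ (⟨c, d - a, -b⟩ : BinQF).eval x y = 0 := by
  by_cases hc : c = 0
  · exact ⟨1, 0, Or.inl one_ne_zero, by simp [BinQF.eval, hc]⟩
  · obtain ⟨k, hk⟩ := hD
    refine ⟨k - (d - a), 2 * c, Or.inr (by omega), ?_⟩
    have h := four_mul_eval a b c d (k - (d - a)) (2 * c)
    rw [hk] at h
    have h0 : 4 * c * (⟨c, d - a, -b⟩ : BinQF).eval (k - (d - a)) (2 * c) = 0 := by rw [h]; ring
    rcases mul_eq_zero.1 h0 with h1 | h1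
    · omega
    · exact h1

/-! ## §4 LEMMA 7.6 (d): type III; indefiniteness for `D > 0` -/

/-- **(d): «`B` is of type III ⟺ `D > 0` and `4D ∈ ℕ` is a square»** — `p_B` splits as `(t − λ_1)(t − λ_2)` with
integers `λ_1 ≠ λ_2` (`λ_1 + λ_2 = a + d`, `λ_1λ_2 = ad − bc`) iff `4D = (a − d)² + 4bc > 0` is a square (parity:
`(a + d + k)(a + d − k) = 4(ad − bc)` makes `a + d + k` even). [cite: HertlingLarabi2026b, §7.2 Lemma 7.6 (d), chunk p0015] -/
theorem typeIII_iff (a b c d : ℤ) :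
    (∃ l₁ l₂ : ℤ, l₁ ≠ l₂ ∧ l₁ + l₂ = a + d ∧ l₁ * l₂ = a * d - b * c) ↔
      0 < (a - d) ^ 2 + 4 * (b * c) ∧ IsSquare ((a - d) ^ 2 + 4 * (b * c)) := by
  constructor
  · rintro ⟨l₁, l₂, hne, hsum, hprod⟩
    have e : (a - d) ^ 2 + 4 * (b * c) = (l₁ - l₂) * (l₁ - l₂) := by
      have : (a - d) ^ 2 + 4 * (b * c) = (a + d) ^ 2 - 4 * (a * d - b * c) := by ring
      rw [this, ← hsum, ← hprod]; ring
    refine ⟨?_, ⟨l₁ - l₂, e⟩⟩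
    rw [e, ← sq]
    exact lt_of_le_of_ne (sq_nonneg _) (Ne.symm (pow_ne_zero 2 (sub_ne_zero.2 hne)))
  · rintro ⟨hpos, k, hk⟩
    have hk0 : k ≠ 0 := by rintro rfl; simp at hk; omega
    have hprod : (a + d + k) * (a + d - k) = 2 * (2 * (a * d - b * c)) := by linear_combination hk
    have heven : Even (a + d + k) := by
      have h2 : Even ((a + d + k) * (a + d - k)) := ⟨2 * (a * d - b * c), by rw [hprod]; ring⟩
      rcases Int.even_mul.1 h2 with h | h
      · exact h
      · rw [Int.even_sub] at h
        rw [Int.even_add]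
        exact h
    obtain ⟨m, hm⟩ := heven
    refine ⟨m, m - k, fun h => hk0 (by linarith), by linarith, ?_⟩
    have h4 : (4 : ℤ) * (m * (m - k)) = 4 * (a * d - b * c) := by
      linear_combination hk - (a + d - k + 2 * m) * hm
    exact mul_left_cancel₀ (by norm_num : (4 : ℤ) ≠ 0) h4

/-- **(d), (e): «Then `q` is indefinite»** — for `4D = (a − d)² + 4bc > 0` the form `q = [c, d − a, −b]` takes a
positive and a negative value (proof: «`det (c, (d−a)/2; (d−a)/2, −b) = −D`», i.e. `4c·q(−(d−a), 2c) = −4c²·4D`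
against `q(1, 0) = c`; for `c = 0`, `q(x, 1) = (d − a)x − b` with `d ≠ a`).
[cite: HertlingLarabi2026b, §7.2 Lemma 7.6 (d)(e) and proof, chunk p0015] -/
theorem indefinite_of_discr_pos {a b c d : ℤ} (hD : 0 < (a - d) ^ 2 + 4 * (b * c)) :
    (∃ x y : ℤ, 0 < (⟨c, d - a, -b⟩ : BinQF).eval x y) ∧ ∃ x y : ℤ, (⟨c, d - a, -b⟩ : BinQF).eval x y < 0 := by
  have h10 : (⟨c, d - a, -b⟩ : BinQF).eval 1 0 = c := by simp [BinQF.eval]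
  have hv : 4 * c * (⟨c, d - a, -b⟩ : BinQF).eval (-(d - a)) (2 * c) =
      -(4 * c ^ 2) * ((a - d) ^ 2 + 4 * (b * c)) := by
    rw [four_mul_eval]; ring
  rcases lt_trichotomy c 0 with hc | hc | hc
  · refine ⟨⟨-(d - a), 2 * c, ?_⟩, ⟨1, 0, by rw [h10]; exact hc⟩⟩
    have hc2 : 0 < c ^ 2 := lt_of_le_of_ne (sq_nonneg c) (Ne.symm (pow_ne_zero 2 hc.ne))
    nlinarith [mul_pos hc2 hD]
  · subst hc
    have he : d - a ≠ 0 := by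
      rintro h; rw [show a - d = -(d - a) by ring, h] at hD; simp at hD
    have he1 : 1 ≤ (d - a) ^ 2 := by
      rw [← sq_abs]; nlinarith [Int.one_le_abs he]
    refine ⟨⟨(d - a) * (|b| + 1), 1, ?_⟩, ⟨-((d - a) * (|b| + 1)), 1, ?_⟩⟩
    · simp only [BinQF.eval]
      nlinarith [le_abs_self b, neg_abs_le b, abs_nonneg b]
    · simp only [BinQF.eval]
      nlinarith [le_abs_self b, neg_abs_le b, abs_nonneg b]
  · refine ⟨⟨1, 0, by rw [h10]; exact hc⟩, ⟨-(d - a), 2 * c, ?_⟩⟩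
    have hc2 : 0 < c ^ 2 := lt_of_le_of_ne (sq_nonneg c) (Ne.symm (pow_ne_zero 2 hc.ne'))
    nlinarith [mul_pos hc2 hD]

/-! ## §5 LEMMA 7.6 (e): type IV -/

/-- **(e): «`0 ∉ q(ℤ² − {0})`»** — if `4D = (a − d)² + 4bc` is NOT a square then `q = [c, d − a, −b]` is anisotropic:
`q(x, y) ≠ 0` for `(x, y) ≠ (0, 0)` (`4c·q = (2cx + (d−a)y)² − 4D·y²`, and `c ≠ 0` by Theorem 7.10 (a)).
[cite: HertlingLarabi2026b, §7.2 Lemma 7.6 (e), chunk p0015] -/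
theorem eval_ne_zero_of_not_isSquare {a b c d : ℤ} (hD : ¬ IsSquare ((a - d) ^ 2 + 4 * (b * c))) {x y : ℤ}
    (hxy : x ≠ 0 ∨ y ≠ 0) : (⟨c, d - a, -b⟩ : BinQF).eval x y ≠ 0 := by
  have hbc : b * c ≠ 0 := mul_ne_zero_of_not_isSquare (by rw [(discr_eq a b c d).1]; exact hD)
  have hc : c ≠ 0 := fun h => hbc (by rw [h, mul_zero])
  intro h0
  have h := four_mul_eval a b c d x y
  rw [h0, mul_zero] at h
  -- `4D·y² = (2cx + (d−a)y)²`
  by_cases hy : y = 0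
  · subst hy
    have : (2 * c * x) ^ 2 = 0 := by linear_combination -h
    have hx : x = 0 := by
      have h2 : 2 * c * x = 0 := pow_eq_zero_iff two_ne_zero |>.1 this
      rcases mul_eq_zero.1 h2 with h3 | h3
      · omega
      · exact h3
    rcases hxy with h' | h' <;> [exact h' hx; exact h' rfl]
  · apply hD
    rw [← Rat.isSquare_intCast_iff]
    refine ⟨(2 * c * x + (d - a) * y : ℚ) / y, ?_⟩
    have hyq : (y : ℚ) ≠ 0 := by exact_mod_cast hy
    field_simp
    have h' : (((a - d) ^ 2 + 4 * (b * c)) * y ^ 2 : ℤ) = (2 * c * x + (d - a) * y) ^ 2 := by linear_combination h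
    have h'' : (((a - d) ^ 2 + 4 * (b * c) : ℤ) : ℚ) * (y : ℚ) ^ 2 = ((2 * c * x + (d - a) * y : ℤ) : ℚ) ^ 2 := by
      exact_mod_cast h'
    push_cast at h'' ⊢
    linear_combination h''

/-- **(e): type IV** — for `4D = (a − d)² + 4bc > 0` not a square: `bc ≠ 0`, `q` is indefinite, and
`0 ∉ q(ℤ² − {0})`. [cite: HertlingLarabi2026b, §7.2 Lemma 7.6 (e), chunk p0015] -/
theorem typeIV {a b c d : ℤ} (hpos : 0 < (a - d) ^ 2 + 4 * (b * c)) (hD : ¬ IsSquare ((a - d) ^ 2 + 4 * (b * c))) :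
    b * c ≠ 0 ∧
      ((∃ x y : ℤ, 0 < (⟨c, d - a, -b⟩ : BinQF).eval x y) ∧ ∃ x y : ℤ, (⟨c, d - a, -b⟩ : BinQF).eval x y < 0) ∧
      ∀ x y : ℤ, (x ≠ 0 ∨ y ≠ 0) → (⟨c, d - a, -b⟩ : BinQF).eval x y ≠ 0 :=
  ⟨mul_ne_zero_of_not_isSquare (by rw [(discr_eq a b c d).1]; exact hD), indefinite_of_discr_pos hpos,
    fun _ _ hxy => eval_ne_zero_of_not_isSquare hD hxy⟩

/-! ## §6 LEMMA 7.6 (f): type V -/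

/-- **(f): type V** — for `4D = (a − d)² + 4bc < 0`: `bc < 0`, and `q = [c, d − a, −b]` is positive definite if `c > 0`,
negative definite if `c < 0`. [cite: HertlingLarabi2026b, §7.2 Lemma 7.6 (f), chunk p0015] -/
theorem typeV {a b c d : ℤ} (hD : (a - d) ^ 2 + 4 * (b * c) < 0) :
    b * c < 0 ∧
      (0 < c → ∀ x y : ℤ, (x ≠ 0 ∨ y ≠ 0) → 0 < (⟨c, d - a, -b⟩ : BinQF).eval x y) ∧
      (c < 0 → ∀ x y : ℤ, (x ≠ 0 ∨ y ≠ 0) → (⟨c, d - a, -b⟩ : BinQF).eval x y < 0) := by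
  have hdisc : (⟨c, d - a, -b⟩ : BinQF).disc < 0 := by rw [(discr_eq a b c d).2]; exact hD
  refine ⟨mul_neg_of_discr_neg (by rw [(discr_eq a b c d).1]; exact hD), fun hc x y hxy =>
    BinQF.eval_pos _ hc hdisc hxy, fun hc x y hxy => ?_⟩
  have hdisc' : (⟨-c, -(d - a), b⟩ : BinQF).disc < 0 := by
    have e : (⟨-c, -(d - a), b⟩ : BinQF).disc = (⟨c, d - a, -b⟩ : BinQF).disc := by simp only [BinQF.disc]; ring
    rw [e]; exact hdisc
  have h := BinQF.eval_pos (⟨-c, -(d - a), b⟩ : BinQF) (neg_pos.2 hc) hdisc' hxy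
  have e : (⟨-c, -(d - a), b⟩ : BinQF).eval x y = -(⟨c, d - a, -b⟩ : BinQF).eval x y := by
    simp only [BinQF.eval]; ring
  rw [e] at h
  exact neg_pos.1 h

/-! ## §7 Exhaustion of the five types; «only `B` of type I is not regular» -/

/-- Type I has `4D = 0` (so it is disjoint from types III–V, and from type II by `q ≠ 0`).
[cite: HertlingLarabi2026b, §7.1 (the five types), chunk p0014] -/
theorem discr_eq_zero_of_binQF_eq_zero {a b c d : ℤ} (h : (⟨c, d - a, -b⟩ : BinQF) = ⟨0, 0, 0⟩) :
    (a - d) ^ 2 + 4 * (b * c) = 0 := by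
  simp only [BinQF.mk.injEq, neg_eq_zero] at h
  obtain ⟨hc, hda, hb⟩ := h
  rw [hc, hb, show a - d = 0 by linarith]
  ring

/-- **«A matrix `B ∈ M_{2×2}(ℤ)` […] is of one of the following five types»**, in the characterisations of
Lemma 7.6 (b)–(f): `q = 0` (I), or `4D = 0 ∧ q ≠ 0` (II), or `4D > 0` a square (III), or `4D > 0` not a square (IV),
or `4D < 0` (V). [cite: HertlingLarabi2026b, §7.1 (the five types) with Lemma 7.6, chunks p0014–p0015] -/
theorem types_exhaustive (a b c d : ℤ) :
    (⟨c, d - a, -b⟩ : BinQF) = ⟨0, 0, 0⟩ ∨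
      ((a - d) ^ 2 + 4 * (b * c) = 0 ∧ (⟨c, d - a, -b⟩ : BinQF) ≠ ⟨0, 0, 0⟩) ∨
      (0 < (a - d) ^ 2 + 4 * (b * c) ∧ IsSquare ((a - d) ^ 2 + 4 * (b * c))) ∨
      (0 < (a - d) ^ 2 + 4 * (b * c) ∧ ¬ IsSquare ((a - d) ^ 2 + 4 * (b * c))) ∨
      (a - d) ^ 2 + 4 * (b * c) < 0 := by
  by_cases hq : (⟨c, d - a, -b⟩ : BinQF) = ⟨0, 0, 0⟩
  · exact Or.inl hq
  rcases lt_trichotomy ((a - d) ^ 2 + 4 * (b * c)) 0 with h | h | h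
  · exact Or.inr (Or.inr (Or.inr (Or.inr h)))
  · exact Or.inr (Or.inl ⟨h, hq⟩)
  · by_cases hs : IsSquare ((a - d) ^ 2 + 4 * (b * c))
    · exact Or.inr (Or.inr (Or.inl ⟨h, hs⟩))
    · exact Or.inr (Or.inr (Or.inr (Or.inl ⟨h, hs⟩)))

/-- **«Only `B` of type I is not regular.»**  For `q_B ≠ 0` (`B` not a scalar matrix) the minimal polynomial of `B`
over `ℚ` is its characteristic polynomial `p_B = t² − (tr B)t + det B` — the regularity hypothesis
`minpoly ℚ B = g` of the Latimer–MacDuffee files (`LatimerMacDuffeeRegularMatrices`, HL26b Thm. 6.2), for every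
integer `2 × 2` matrix of types II–V. [cite: HertlingLarabi2026b, §7.1 («Only `B` of type I is not regular»), chunk p0014] -/
theorem minpoly_eq_of_binQF_ne_zero {B : Matrix (Fin 2) (Fin 2) ℤ}
    (hq : (⟨B 1 0, B 1 1 - B 0 0, -B 0 1⟩ : BinQF) ≠ ⟨0, 0, 0⟩) :
    minpoly ℚ (B.map (Int.castRingHom ℚ)) = X ^ 2 - C (B.trace : ℚ) * X + C (B.det : ℚ) := by
  set M : Matrix (Fin 2) (Fin 2) ℚ := B.map (Int.castRingHom ℚ) with hM
  have htr : M.trace = (B.trace : ℚ) := by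
    simp [hM, Matrix.trace_fin_two, Matrix.map_apply]
  have hdet : M.det = (B.det : ℚ) := by
    simp [hM, Matrix.det_fin_two, Matrix.map_apply]
  have hchar : M.charpoly = X ^ 2 - C (B.trace : ℚ) * X + C (B.det : ℚ) := by
    rw [Matrix.charpoly_fin_two, htr, hdet]
  have hcm : M.charpoly.Monic := Matrix.charpoly_monic M
  have hcd : M.charpoly.natDegree = 2 := by rw [Matrix.charpoly_natDegree_eq_dim, Fintype.card_fin]
  have hint : IsIntegral ℚ M := Matrix.isIntegral M
  have hmm : (minpoly ℚ M).Monic := minpoly.monic hint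
  have hdvd : minpoly ℚ M ∣ M.charpoly := Matrix.minpoly_dvd_charpoly M
  have hle : (minpoly ℚ M).natDegree ≤ 2 := by
    have h := Polynomial.natDegree_le_of_dvd hdvd hcm.ne_zero
    rwa [hcd] at h
  have hpos : 0 < (minpoly ℚ M).natDegree := minpoly.natDegree_pos hint
  rcases Nat.lt_or_ge (minpoly ℚ M).natDegree 2 with hlt | hge
  · -- degree `1`: `minpoly = X + C μ`, so `M = −μE_2` is scalar and `q = 0`
    exfalso
    have h1 : (minpoly ℚ M).natDegree = 1 := by omega
    have hX := hmm.eq_X_add_C h1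
    have h0 := minpoly.aeval ℚ M
    rw [hX, map_add, aeval_X, aeval_C] at h0
    have e := fun i j => congr_fun (congr_fun h0 i) j
    have e00 := e 0 0
    have e01 := e 0 1
    have e10 := e 1 0
    have e11 := e 1 1
    simp [hM, Matrix.algebraMap_matrix_apply] at e00 e01 e10 e11
    apply hq
    have hb : B 0 1 = 0 := by exact_mod_cast e01
    have hc : B 1 0 = 0 := by exact_mod_cast e10
    have had : (B 0 0 : ℚ) = B 1 1 := by linarith
    have had' : B 0 0 = B 1 1 := by exact_mod_cast had
    ext <;> simp [hb, hc, had']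
  · rw [← hchar]
    exact (Polynomial.eq_of_monic_of_dvd_of_natDegree_le hmm hcm hdvd (by rw [hcd]; exact hge)).symm

end Literature.LinearAlgebra.Matrix.IntegerMatrixTwoByTwoTypes
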